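import Literature.Analysis.FluidPDE.ExtremeGrowthValueFunction
import Literature.Analysis.FluidPDE.ClassicalSolutionRescale
import Literature.Analysis.FluidPDE.ClassicalSolutionTorusProofs
import HarnessLib

/-!
# Exact scaling covariance of the extreme-enstrophy-growth value function on the fixed torus

Cell `pub-fluidc` (FLUID COMPUTER; host summit `NavierStokesRegularity`, negation side, machine
paradigm), prover seat p1 — the EXTREMAL FACE of the atlas ("H-ladder", `HOME/FARM.md` §3/§11,
`HOME/PLAN.md` §3 p1). HONEST FRAMING: low prior, high value-of-information experiment on Tao's
machine paradigm; NOT a claim that NS blows up. Nothing here asserts any floating-point value.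

The optimiser farm climbs the Kang–Yun–Protas value function `Φ_T(ℰ₀; ν)`
(`Literature.Analysis.FluidPDE.kypMaxEnstrophy d ν ℰ₀ T`: the supremum of `ℰ(u(T))` over
classical zero-mean solutions of unforced Navier–Stokes on the unit torus with `ℰ(u(0)) = ℰ₀`)
in the "rung coordinates" `Ê = ℰ₀/ν²`, `T̂ = νT` (`FARM.md`: `E_hat = E0 L/ν²` with `L = 1`;
`T̃(ℰ₀) ∝ Ê^{-1/2}`), on the grounds that the Navier–Stokes system on a FIXED torus is covariant
under the time–amplitude rescaling

`u ↦ α u(α t, x)`, `p ↦ α² p(α t, x)`, `f ↦ α² f(α t, x)`, `ν ↦ α ν`   (`α > 0`),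

which multiplies every enstrophy by `α²` and divides the horizon by `α`. This file PROVES that
covariance for the tree's classical torus solutions and the resulting exact identity of value
functions:

* `isClassicalNSSolutionOn_timeAmp` — the rescaled pair solves the system with viscosity `α ν`
  on the rescaled time set (from the tree's whole-space covariance
  `IsClassicalNSSolutionOn.stRescale` with `γ = 1`, transported through the torus ↔ periodic-lift
  bridge `IsClassicalNSSolutionOn.of_torus_holds` / `to_torus_holds`);
* `torusEnstrophy_fun_const_smul` — `ℰ(c • v) = c² ℰ(v)` (unconditionally: junk-safe);
* `admissibleEquiv` — the rescaling is a bijection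
  `Admissible d ν ℰ₀ T ≃ Admissible d (α ν) (α² ℰ₀) (T/α)`;
* `kypMaxEnstrophy_timeAmp` — **`Φ_{T/α}(α² ℰ₀; α ν) = α² Φ_T(ℰ₀; ν)`** (no side condition on
  `ℰ₀`, `T`; the junk conventions of the real `iSup` on both sides correspond under the bijection);
* `kypMaxEnstrophy_eq_unit_viscosity` — **`Φ_T(ℰ₀; ν) = ν² Φ_{νT}(ℰ₀/ν²; 1)`**: the value function
  depends on `(ℰ₀, ν, T)` only through `Ê = ℰ₀/ν²` and `T̂ = νT`, up to the factor `ν²`; and the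
  growth RATIO `Φ_T(ℰ₀; ν)/ℰ₀ = Φ_{T̂}(Ê; 1)/Ê` (`growth_ratio_eq_unit_viscosity`) is an exact
  function of the rung coordinates — which is what makes "level `Ê`" a well-defined rung.

What this does NOT say: levels with different `Ê` (the ladder `ℰ₀ = 1000 … 8000` at fixed
`ν = 0.01`) are genuinely different problems; no law `Φ ∝ ℰ₀^a` follows from scaling.
-/

noncomputable section

open Set Function MeasureTheory

namespace Summit.NavierStokesRegularity.FluidComputer.ExtremeGrowthScaling

open Literature.Analysis.FluidPDE Literature.Analysis.FunctionSpaces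

variable {d : Type*} [Fintype d] [DecidableEq d]

/-! ### The time–amplitude rescaling -/

/-- Time–amplitude rescaling of a space–time field on the torus:
`timeAmp α c w s x = c • w (α s) x`. -/
def timeAmp {F : Type*} [SMul ℝ F] (α c : ℝ) (w : ℝ → UnitAddTorus d → F) :
    ℝ → UnitAddTorus d → F :=
  fun s x => c • w (α * s) x

omit [Fintype d] [DecidableEq d] in
/-- Unfolding `timeAmp`. -/
@[simp]
theorem timeAmp_apply {F : Type*} [SMul ℝ F] (α c : ℝ) (w : ℝ → UnitAddTorus d → F) (s : ℝ)
    (x : UnitAddTorus d) : timeAmp α c w s x = c • w (α * s) x := rfl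

omit [Fintype d] [DecidableEq d] in
/-- The rescaled zero force is zero. -/
@[simp]
theorem timeAmp_zero (α c : ℝ) :
    timeAmp (d := d) α c (0 : ℝ → UnitAddTorus d → EuclideanSpace ℝ d) = 0 := by
  funext s x; simp [timeAmp]

/-- **Covariance of classical torus solutions under the time–amplitude rescaling.** If `(u, p)`
solves `∂ₜu + (u·∇)u = νΔu − ∇p + f`, `div u = 0` classically on `S × 𝕋ᵈ`, then for `α > 0`
the pair `(α u(α·), α² p(α·))` solves the system with viscosity `α ν` and force `α² f(α·)`
classically on `{s | α s ∈ S} × 𝕋ᵈ` (the whole-space statement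
`IsClassicalNSSolutionOn.stRescale` with `γ = 1`, `β = α`, `t₀ = 0`, `x₀ = 0`, moved through the
periodic lift). -/
theorem isClassicalNSSolutionOn_timeAmp {S : Set ℝ} {ν : ℝ}
    {f u : ℝ → UnitAddTorus d → EuclideanSpace ℝ d} {p : ℝ → UnitAddTorus d → ℝ}
    (h : Torus.IsClassicalNSSolutionOn S ν f u p) {α : ℝ} (hα : 0 < α) :
    Torus.IsClassicalNSSolutionOn ((fun r => α * r) ⁻¹' S) (α * ν) (timeAmp α (α ^ 2) f)
      (timeAmp α α u) (timeAmp α (α ^ 2) p) := by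
  have hE := IsClassicalNSSolutionOn.of_torus_holds h
  have hR := hE.stRescale hα one_pos (mul_one α).symm 0 (0 : EuclideanSpace ℝ d)
  have hS : ((fun r => (0 : ℝ) + α * r) ⁻¹' S) = (fun r => α * r) ⁻¹' S := by
    ext r; simp
  have hν : α * ν / 1 = α * ν := div_one _
  have hf : ((α ^ 2 * 1) • stPull α 1 0 (0 : EuclideanSpace ℝ d) (fun t => Torus.lift (f t))) =
      fun s => Torus.lift (timeAmp α (α ^ 2) f s) := by
    funext s y; simp [stPull_apply, Torus.lift_apply, timeAmp]
  have hu : (α • stPull α 1 0 (0 : EuclideanSpace ℝ d) (fun t => Torus.lift (u t))) =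
      fun s => Torus.lift (timeAmp α α u s) := by
    funext s y; simp [stPull_apply, Torus.lift_apply, timeAmp]
  have hp : (α ^ 2 • stPull α 1 0 (0 : EuclideanSpace ℝ d) (fun t => Torus.lift (p t))) =
      fun s => Torus.lift (timeAmp α (α ^ 2) p s) := by
    funext s y; simp [stPull_apply, Torus.lift_apply, timeAmp]
  rw [hS, hν, hf, hu, hp] at hR
  exact IsClassicalNSSolutionOn.to_torus_holds hR

/-! ### Enstrophy and mean under constant multiples -/

omit [Fintype d] in
/-- `∂ᵢ (c • v) = c • ∂ᵢ v` pointwise, with no differentiability hypothesis (the derivative of a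
constant multiple over a field; junk-safe). -/
theorem partialDeriv_fun_const_smul {F : Type*} [NormedAddCommGroup F] [NormedSpace ℝ F]
    (c : ℝ) (v : UnitAddTorus d → F) (i : d) (x : UnitAddTorus d) :
    Torus.partialDeriv i (fun y => c • v y) x = c • Torus.partialDeriv i v x := by
  simp only [Torus.partialDeriv, Torus.lineDeriv]
  exact deriv_fun_const_smul_field c _

/-- `‖∇(c • v)‖₂² = c² ‖∇v‖₂²` (unconditionally). -/
theorem gradNormSq_fun_const_smul (c : ℝ) (v : UnitAddTorus d → EuclideanSpace ℝ d) :
    Torus.gradNormSq (fun x => c • v x) = c ^ 2 * Torus.gradNormSq v := by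
  unfold Torus.gradNormSq
  rw [← integral_const_mul]
  congr 1
  funext x
  rw [Finset.mul_sum]
  refine Finset.sum_congr rfl fun i _ => ?_
  rw [partialDeriv_fun_const_smul, norm_smul, mul_pow, Real.norm_eq_abs, sq_abs]

/-- **`ℰ(c • v) = c² ℰ(v)`** (unconditionally). -/
theorem torusEnstrophy_fun_const_smul (c : ℝ) (v : UnitAddTorus d → EuclideanSpace ℝ d) :
    torusEnstrophy (fun x => c • v x) = c ^ 2 * torusEnstrophy v := by
  unfold torusEnstrophy
  rw [gradNormSq_fun_const_smul]
  ring

omit [DecidableEq d] in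
/-- Zero mean is preserved by constant multiples. -/
theorem hasZeroMean_fun_const_smul {v : UnitAddTorus d → EuclideanSpace ℝ d}
    (hv : Torus.HasZeroMean v) (c : ℝ) : Torus.HasZeroMean (fun x => c • v x) := by
  unfold Torus.HasZeroMean at hv ⊢
  rw [integral_smul, hv, smul_zero]

/-! ### The rescaling on admissible pairs -/

/-- For `α > 0`, `{r | α r ∈ [0, T]} = [0, T/α]`. -/
theorem preimage_mul_Icc {α : ℝ} (hα : 0 < α) (T : ℝ) :
    (fun r => α * r) ⁻¹' Icc 0 T = Icc 0 (T / α) := by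
  ext r
  simp only [mem_preimage, mem_Icc, le_div_iff₀ hα, mul_comm r α, mul_nonneg_iff_of_pos_left hα]

/-- For `α > 0` and `t ∈ [0, T/α]`, `α t ∈ [0, T]`. -/
theorem mul_mem_Icc_of_mem {α : ℝ} (hα : 0 < α) {T t : ℝ} (ht : t ∈ Icc 0 (T / α)) :
    α * t ∈ Icc 0 T := by
  have : t ∈ (fun r => α * r) ⁻¹' Icc 0 T := by rw [preimage_mul_Icc hα]; exact ht
  exact this

/-- The rescaling of a velocity–pressure pair: `(α u(α·), α² p(α·))`. -/
def rescalePair (α : ℝ)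
    (s : (ℝ → UnitAddTorus d → EuclideanSpace ℝ d) × (ℝ → UnitAddTorus d → ℝ)) :
    (ℝ → UnitAddTorus d → EuclideanSpace ℝ d) × (ℝ → UnitAddTorus d → ℝ) :=
  (timeAmp α α s.1, timeAmp α (α ^ 2) s.2)

omit [Fintype d] [DecidableEq d] in
/-- Rescaling by `α⁻¹` undoes rescaling by `α ≠ 0`. -/
theorem rescalePair_inv_rescalePair {α : ℝ} (hα : α ≠ 0)
    (s : (ℝ → UnitAddTorus d → EuclideanSpace ℝ d) × (ℝ → UnitAddTorus d → ℝ)) :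
    rescalePair α⁻¹ (rescalePair α s) = s := by
  obtain ⟨u, p⟩ := s
  simp only [rescalePair, Prod.mk.injEq]
  constructor
  · funext t x
    simp [timeAmp, smul_smul, hα]
  · funext t x
    simp [timeAmp, hα]

/-- **The rescaling maps admissible pairs to admissible pairs**: `s ∈ Admissible d ν ℰ₀ T` gives
`rescalePair α s ∈ Admissible d (α ν) (α² ℰ₀) (T/α)` for `α > 0` (stated with the target
parameters as free variables tied by equations, for painless reuse at `α⁻¹`). -/
theorem mem_admissible_rescalePair {α : ℝ} (hα : 0 < α) {ν ℰ₀ T ν' ℰ₀' T' : ℝ}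
    (hν' : ν' = α * ν) (hE' : ℰ₀' = α ^ 2 * ℰ₀) (hT' : T' = T / α)
    {s : (ℝ → UnitAddTorus d → EuclideanSpace ℝ d) × (ℝ → UnitAddTorus d → ℝ)}
    (hs : s ∈ Admissible d ν ℰ₀ T) : rescalePair α s ∈ Admissible d ν' ℰ₀' T' := by
  subst hν' hE' hT'
  obtain ⟨hsol, hmean, hE0, hpos⟩ := hs
  refine ⟨?_, ?_, ?_, ?_⟩
  · have h1 := isClassicalNSSolutionOn_timeAmp hsol hα
    rw [preimage_mul_Icc hα, timeAmp_zero] at h1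
    exact h1
  · intro t ht
    exact hasZeroMean_fun_const_smul (hmean (α * t) (mul_mem_Icc_of_mem hα ht)) α
  · show torusEnstrophy (fun x => α • s.1 (α * 0) x) = α ^ 2 * ℰ₀
    rw [mul_zero, torusEnstrophy_fun_const_smul, hE0]
  · intro t ht
    show 0 < torusEnstrophy (fun x => α • s.1 (α * t) x)
    rw [torusEnstrophy_fun_const_smul]
    exact mul_pos (pow_pos hα 2) (hpos (α * t) (mul_mem_Icc_of_mem hα ht))

/-- **The rescaling is a bijection of admissible sets**
`Admissible d ν ℰ₀ T ≃ Admissible d (α ν) (α² ℰ₀) (T/α)`, `α > 0`, with inverse the rescaling by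
`α⁻¹`. -/
def admissibleEquiv {α : ℝ} (hα : 0 < α) (ν ℰ₀ T : ℝ) :
    Admissible d ν ℰ₀ T ≃ Admissible d (α * ν) (α ^ 2 * ℰ₀) (T / α) where
  toFun s := ⟨rescalePair α s.1, mem_admissible_rescalePair hα rfl rfl rfl s.2⟩
  invFun s := ⟨rescalePair α⁻¹ s.1, mem_admissible_rescalePair (inv_pos.2 hα)
    (by rw [← mul_assoc, inv_mul_cancel₀ hα.ne', one_mul])
    (by rw [← mul_assoc, ← mul_pow, inv_mul_cancel₀ hα.ne', one_pow, one_mul])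
    (by rw [div_div, mul_inv_cancel₀ hα.ne', div_one]) s.2⟩
  left_inv s := Subtype.ext (rescalePair_inv_rescalePair hα.ne' s.1)
  right_inv s := Subtype.ext (by
    simpa only [inv_inv] using rescalePair_inv_rescalePair (inv_ne_zero hα.ne') s.1)

/-! ### The value-function identities -/

/-- **Exact scaling covariance of the KYP value function on the fixed torus**:
`Φ_{T/α}(α² ℰ₀; α ν) = α² Φ_T(ℰ₀; ν)` for every `α > 0` (and all real `ν`, `ℰ₀`, `T`). -/
theorem kypMaxEnstrophy_timeAmp {α : ℝ} (hα : 0 < α) (ν ℰ₀ T : ℝ) :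
    kypMaxEnstrophy d (α * ν) (α ^ 2 * ℰ₀) (T / α) = α ^ 2 * kypMaxEnstrophy d ν ℰ₀ T := by
  unfold kypMaxEnstrophy
  rw [Real.mul_iSup_of_nonneg (sq_nonneg α)]
  refine (Equiv.iSup_congr (admissibleEquiv (d := d) hα ν ℰ₀ T) fun s => ?_).symm
  show torusEnstrophy (fun x => α • s.1.1 (α * (T / α)) x) = α ^ 2 * torusEnstrophy (s.1.1 T)
  rw [mul_div_cancel₀ T hα.ne', torusEnstrophy_fun_const_smul]

/-- **The rung coordinates are exact**: `Φ_T(ℰ₀; ν) = ν² Φ_{νT}(ℰ₀/ν²; 1)` for `ν > 0` — the value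
function depends on `(ℰ₀, ν, T)` only through `Ê = ℰ₀/ν²` and `T̂ = νT`, up to the factor `ν²`. -/
theorem kypMaxEnstrophy_eq_unit_viscosity {ν : ℝ} (hν : 0 < ν) (ℰ₀ T : ℝ) :
    kypMaxEnstrophy d ν ℰ₀ T = ν ^ 2 * kypMaxEnstrophy d 1 (ℰ₀ / ν ^ 2) (ν * T) := by
  have h := kypMaxEnstrophy_timeAmp (d := d) (inv_pos.2 hν) ν ℰ₀ T
  have e1 : ν⁻¹ * ν = 1 := inv_mul_cancel₀ hν.ne'
  have e2 : ν⁻¹ ^ 2 * ℰ₀ = ℰ₀ / ν ^ 2 := by rw [inv_pow, inv_mul_eq_div]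
  have e3 : T / ν⁻¹ = ν * T := by rw [div_inv_eq_mul, mul_comm]
  rw [e1, e2, e3] at h
  rw [h, ← mul_assoc, ← mul_pow, mul_inv_cancel₀ hν.ne', one_pow, one_mul]

/-- **The growth ratio is a function of the rung coordinates**:
`Φ_T(ℰ₀; ν)/ℰ₀ = Φ_{T̂}(Ê; 1)/Ê` with `Ê = ℰ₀/ν²`, `T̂ = νT` (`ν > 0`, `ℰ₀ ≠ 0`). -/
theorem growth_ratio_eq_unit_viscosity {ν ℰ₀ : ℝ} (hν : 0 < ν) (hE : ℰ₀ ≠ 0) (T : ℝ) :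
    kypMaxEnstrophy d ν ℰ₀ T / ℰ₀ =
      kypMaxEnstrophy d 1 (ℰ₀ / ν ^ 2) (ν * T) / (ℰ₀ / ν ^ 2) := by
  rw [kypMaxEnstrophy_eq_unit_viscosity hν]
  have hν2 : ν ^ 2 ≠ 0 := pow_ne_zero 2 hν.ne'
  field_simp

/-- **Two problems with the same rung coordinates have proportional values**: if
`ℰ₀/ν² = ℰ₀'/ν'²` and `νT = ν'T'` (`ν, ν' > 0`), then `Φ_{T'}(ℰ₀'; ν')/ν'² = Φ_T(ℰ₀; ν)/ν²`. -/
theorem kypMaxEnstrophy_div_sq_eq_of_rung_eq {ν ν' ℰ₀ ℰ₀' T T' : ℝ} (hν : 0 < ν) (hν' : 0 < ν')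
    (hE : ℰ₀ / ν ^ 2 = ℰ₀' / ν' ^ 2) (hT : ν * T = ν' * T') :
    kypMaxEnstrophy d ν' ℰ₀' T' / ν' ^ 2 = kypMaxEnstrophy d ν ℰ₀ T / ν ^ 2 := by
  rw [kypMaxEnstrophy_eq_unit_viscosity hν, kypMaxEnstrophy_eq_unit_viscosity hν', ← hE, ← hT,
    mul_div_cancel_left₀ _ (pow_ne_zero 2 hν'.ne'), mul_div_cancel_left₀ _ (pow_ne_zero 2 hν.ne')]

/-! ### Symmetry-restricted value functions (the farm's `M_G8`: maximum within a class) -/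

/-- **Covariance of the RESTRICTED value function.** If the class `C` of velocity–pressure pairs is
mapped into itself by the rescalings with `α` and `α⁻¹` (e.g. a class defined by SPATIAL
symmetries — the farm's `G8kp` branch — since `rescalePair` acts on time and amplitude only), then
`Φ^C_{T/α}(α² ℰ₀; α ν) = α² Φ^C_T(ℰ₀; ν)` (`α > 0`). -/
theorem kypMaxEnstrophyIn_timeAmp {α : ℝ} (hα : 0 < α) (ν ℰ₀ T : ℝ)
    {C : Set ((ℝ → UnitAddTorus d → EuclideanSpace ℝ d) × (ℝ → UnitAddTorus d → ℝ))}
    (hC : ∀ s ∈ C, rescalePair α s ∈ C) (hC' : ∀ s ∈ C, rescalePair α⁻¹ s ∈ C) :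
    kypMaxEnstrophyIn d (α * ν) (α ^ 2 * ℰ₀) (T / α) C = α ^ 2 * kypMaxEnstrophyIn d ν ℰ₀ T C := by
  unfold kypMaxEnstrophyIn
  rw [Real.mul_iSup_of_nonneg (sq_nonneg α)]
  let e : (Admissible d ν ℰ₀ T ∩ C : Set _) ≃ (Admissible d (α * ν) (α ^ 2 * ℰ₀) (T / α) ∩ C : Set _) :=
    { toFun := fun s => ⟨rescalePair α s.1, mem_admissible_rescalePair hα rfl rfl rfl s.2.1, hC _ s.2.2⟩
      invFun := fun s => ⟨rescalePair α⁻¹ s.1, mem_admissible_rescalePair (inv_pos.2 hα)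
        (by rw [← mul_assoc, inv_mul_cancel₀ hα.ne', one_mul])
        (by rw [← mul_assoc, ← mul_pow, inv_mul_cancel₀ hα.ne', one_pow, one_mul])
        (by rw [div_div, mul_inv_cancel₀ hα.ne', div_one]) s.2.1, hC' _ s.2.2⟩
      left_inv := fun s => Subtype.ext (rescalePair_inv_rescalePair hα.ne' s.1)
      right_inv := fun s => Subtype.ext (by
        simpa only [inv_inv] using rescalePair_inv_rescalePair (inv_ne_zero hα.ne') s.1) }
  refine (Equiv.iSup_congr e fun s => ?_).symm
  show torusEnstrophy (fun x => α • s.1.1 (α * (T / α)) x) = α ^ 2 * torusEnstrophy (s.1.1 T)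
  rw [mul_div_cancel₀ T hα.ne', torusEnstrophy_fun_const_smul]

/-- Restricted rung coordinates: `Φ^C_T(ℰ₀; ν) = ν² Φ^C_{νT}(ℰ₀/ν²; 1)` for a class `C` stable
under all time–amplitude rescalings (`ν > 0`). -/
theorem kypMaxEnstrophyIn_eq_unit_viscosity {ν : ℝ} (hν : 0 < ν) (ℰ₀ T : ℝ)
    {C : Set ((ℝ → UnitAddTorus d → EuclideanSpace ℝ d) × (ℝ → UnitAddTorus d → ℝ))}
    (hC : ∀ β : ℝ, 0 < β → ∀ s ∈ C, rescalePair β s ∈ C) :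
    kypMaxEnstrophyIn d ν ℰ₀ T C = ν ^ 2 * kypMaxEnstrophyIn d 1 (ℰ₀ / ν ^ 2) (ν * T) C := by
  have h := kypMaxEnstrophyIn_timeAmp (d := d) (inv_pos.2 hν) ν ℰ₀ T (C := C)
    (hC _ (inv_pos.2 hν)) (by simpa only [inv_inv] using hC ν⁻¹⁻¹ (by rw [inv_inv]; exact hν))
  have e1 : ν⁻¹ * ν = 1 := inv_mul_cancel₀ hν.ne'
  have e2 : ν⁻¹ ^ 2 * ℰ₀ = ℰ₀ / ν ^ 2 := by rw [inv_pow, inv_mul_eq_div]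
  have e3 : T / ν⁻¹ = ν * T := by rw [div_inv_eq_mul, mul_comm]
  rw [e1, e2, e3] at h
  rw [h, ← mul_assoc, ← mul_pow, mul_inv_cancel₀ hν.ne', one_pow, one_mul]

end Summit.NavierStokesRegularity.FluidComputer.ExtremeGrowthScaling

end
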